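import Literature.Geometry.Riemannian.PerelmanEntropyCutoff
import Mathlib.Analysis.SpecialFunctions.SmoothTransition
import Mathlib.Analysis.InnerProductSpace.Calculus
import HarnessLib

/-!
# Cone exclusion for line `ancient-sphere-rigidity` — helpers

Crux `EntropyRung.SubcylindricalRecognition` (stmt-SmoothPoincare4-10869), line `ancient-sphere-rigidity`,
skeleton r6: the lead's glue `stub_blowdownAssembly` excludes orbifold cone points of Bamler's blow-down
shrinker by bounding Perelman's `μ`-entropy of a rescaled compact approximant from above with a
`Γ`-invariant Gaussian annulus test function. This file holds the elementary helpers of that glue: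

* `neg_log_lt_nuCyl_add` — `-log k < ν_cyl + δ'` for `k ≥ 2`;
* `contMDiff_of_contMDiffOn_of_eq_zero`, `continuous_of_continuousOn_of_eq_zero` — zero extension;
* `exists_ball_sq_norm_comparison` — a bilinear-form-valued map continuous on a ball and Euclidean at the
  centre is `(1±θ)`-comparable to `|·|²` on a smaller ball;
* `gradSq_descent_le` (registered helper) — `|∇ρ|²_h ≤ 4|y|²/(1-η)` for the descent `ρ` of `|y|²` under a
  `(1-η)`-expanding local diffeomorphism;
* `profile_props` — the radial profile `W(s) = e^{-s/8τ} T(s/(2ε²) - 1) T(3 - 4s/r'²)`.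

All fact-free (Mathlib + the tree's `gradSq`/`sharp` API).
-/

noncomputable section

open scoped Manifold ContDiff Topology ENNReal NNReal ContinuousMap
open Set MeasureTheory Filter
open Literature.Geometry.Lorentzian Literature.Geometry.Riemannian

namespace Summit.SmoothPoincare4.SmoothPoincare4.Theorems.SubcylindricalRecognition.AncientSphereRigidity

section Helpers

/-- `-log k < ν_cyl + δ'` for `k ≥ 2`, `δ' > 0`: `-log k ≤ -log 2` and `2 log 2 + (log π)/2 > 3/2`
(`log 2 > 0.693`, `log π > 1` since `π > 3 > e`). [folklore] -/
theorem neg_log_lt_nuCyl_add {k : ℕ} (hk : 2 ≤ k) {δ' : ℝ} (hδ' : 0 < δ') :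
    -Real.log k < Real.log 2 + Real.log Real.pi / 2 - 3 / 2 + δ' := by
  have hk' : (2 : ℝ) ≤ k := by exact_mod_cast hk
  have hlogk : Real.log 2 ≤ Real.log k := Real.log_le_log (by norm_num) hk'
  have h2 : (0.6931471803 : ℝ) < Real.log 2 := Real.log_two_gt_d9
  have hpi : 1 < Real.log Real.pi := by
    rw [← Real.log_exp 1]
    refine Real.log_lt_log (Real.exp_pos 1) ?_
    have := Real.exp_one_lt_d9
    have := Real.pi_gt_three
    linarith
  linarith

/-- Zero extension: a function smooth on an open `V`, vanishing off a closed `K ⊆ V`, is smooth. [folklore] -/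
theorem contMDiff_of_contMDiffOn_of_eq_zero {M : Type} [TopologicalSpace M]
    [ChartedSpace (EuclideanSpace ℝ (Fin 4)) M] {F : M → ℝ} {V K : Set M} (hV : IsOpen V)
    (hK : IsClosed K) (hKV : K ⊆ V) (hF : ContMDiffOn (𝓡 4) 𝓘(ℝ, ℝ) ∞ F V)
    (h0 : ∀ x ∉ K, F x = 0) : ContMDiff (𝓡 4) 𝓘(ℝ, ℝ) ∞ F := by
  intro x
  by_cases hx : x ∈ K
  · exact (hF x (hKV hx)).contMDiffAt (hV.mem_nhds (hKV hx))
  · have hev : F =ᶠ[𝓝 x] fun _ ↦ (0 : ℝ) := by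
      filter_upwards [hK.isOpen_compl.mem_nhds hx] with y hy using h0 y hy
    exact contMDiffAt_const.congr_of_eventuallyEq hev

/-- Zero extension, continuous version. [folklore] -/
theorem continuous_of_continuousOn_of_eq_zero {M : Type} [TopologicalSpace M] {F : M → ℝ} {V K : Set M} (hV : IsOpen V)
    (hK : IsClosed K) (hKV : K ⊆ V) (hF : ContinuousOn F V)
    (h0 : ∀ x ∉ K, F x = 0) : Continuous F := by
  rw [continuous_iff_continuousAt]
  intro x
  by_cases hx : x ∈ K
  · exact (hF x (hKV hx)).continuousAt (hV.mem_nhds (hKV hx))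
  · have hev : F =ᶠ[𝓝 x] fun _ ↦ (0 : ℝ) := by
      filter_upwards [hK.isOpen_compl.mem_nhds hx] with y hy using h0 y hy
    exact (continuousAt_const.congr hev.symm)

/-- A bilinear-form-valued map continuous on a ball and Euclidean at the centre is `(1±θ)`-close to
the Euclidean square norm on a smaller ball. [folklore] -/
theorem exists_ball_sq_norm_comparison
    {G : EuclideanSpace ℝ (Fin 4) →
      (EuclideanSpace ℝ (Fin 4) →L[ℝ] EuclideanSpace ℝ (Fin 4) →L[ℝ] ℝ)}
    {r θ : ℝ} (hr : 0 < r) (hθ : 0 < θ) (hG : ContinuousOn G (Metric.ball 0 r))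
    (hG0 : ∀ v w, G 0 v w = inner ℝ v w) :
    ∃ r₁ : ℝ, 0 < r₁ ∧ r₁ < r ∧ ∀ y ∈ Metric.ball (0 : EuclideanSpace ℝ (Fin 4)) r₁,
      ∀ v : EuclideanSpace ℝ (Fin 4),
        (1 - θ) * ‖v‖ ^ 2 ≤ G y v v ∧ G y v v ≤ (1 + θ) * ‖v‖ ^ 2 := by
  have h0 : (0 : EuclideanSpace ℝ (Fin 4)) ∈ Metric.ball 0 r := Metric.mem_ball_self hr
  have hc : ContinuousAt G 0 := (hG 0 h0).continuousAt (Metric.isOpen_ball.mem_nhds h0)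
  obtain ⟨δ, hδ, hδG⟩ := (@NormedAddCommGroup.tendsto_nhds_nhds _ _ _ _ G 0 (G 0)).mp hc θ hθ
  refine ⟨min δ r / 2, by positivity, by
    have := min_le_right δ r; linarith, fun y hy v ↦ ?_⟩
  have hyδ : ‖y - 0‖ < δ := by
    have := min_le_left δ r
    rw [Metric.mem_ball, dist_eq_norm] at hy
    linarith
  have hGG : ‖G y - G 0‖ < θ := hδG y hyδ
  have hvv : G 0 v v = ‖v‖ ^ 2 := by rw [hG0, real_inner_self_eq_norm_sq]
  have hdiff : |G y v v - ‖v‖ ^ 2| ≤ θ * ‖v‖ ^ 2 := by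
    have h1 : G y v v - ‖v‖ ^ 2 = (G y - G 0) v v := by
      rw [← hvv]; simp only [sub_apply]
    rw [h1]
    calc |(G y - G 0) v v| = ‖(G y - G 0) v v‖ := (Real.norm_eq_abs _).symm
      _ ≤ ‖(G y - G 0) v‖ * ‖v‖ := ContinuousLinearMap.le_opNorm _ _
      _ ≤ ‖G y - G 0‖ * ‖v‖ * ‖v‖ := by
          gcongr; exact ContinuousLinearMap.le_opNorm _ _
      _ ≤ θ * ‖v‖ * ‖v‖ := by gcongr
      _ = θ * ‖v‖ ^ 2 := by ring
  constructor <;> nlinarith [abs_le.mp hdiff]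

end Helpers

section GradSq

/-- **Gradient of the descended radius-squared under an almost isometry.** If `Φ` is a local
diffeomorphism of an open `A ⊆ ℝ⁴` into `M` with `h(dΦ v, dΦ v) ≥ (1-η)|v|²` at `y` and `ρ ∘ Φ = |·|²`
on `A`, then `|∇ρ|²_h (Φ y) ≤ 4|y|²/(1-η)`. [folklore] -/
theorem gradSq_descent_le :
    ∀ (M : Type) [TopologicalSpace M]
      [ChartedSpace (EuclideanSpace ℝ (Fin 4)) M] [IsManifold (𝓡 4) ∞ M]
      (h : PseudoRiemannianMetric (𝓡 4) ∞ (EuclideanSpace ℝ (Fin 4)) (TangentSpace (𝓡 4) : M → Type _))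
      {Φ : EuclideanSpace ℝ (Fin 4) → M} {ρ : M → ℝ} {A : Set (EuclideanSpace ℝ (Fin 4))}
      {V : Set M} {η : ℝ} (hη : η < 1) (hA : IsOpen A) (hV : IsOpen V)
      (hΦ : ContMDiffOn (𝓡 4) (𝓡 4) ∞ Φ A) (hρ : ContMDiffOn (𝓡 4) 𝓘(ℝ, ℝ) ∞ ρ V)
      (hAV : Set.MapsTo Φ A V) (hdesc : ∀ y ∈ A, ρ (Φ y) = ‖y‖ ^ 2)
      {y : EuclideanSpace ℝ (Fin 4)} (hy : y ∈ A)
      (hinj : Function.Injective (mfderiv (𝓡 4) (𝓡 4) Φ y))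
      (hcomp : ∀ v : EuclideanSpace ℝ (Fin 4),
        (1 - η) * ‖v‖ ^ 2 ≤ h.val (Φ y) (mfderiv (𝓡 4) (𝓡 4) Φ y v) (mfderiv (𝓡 4) (𝓡 4) Φ y v)),
      h.gradSq ρ (Φ y) ≤ 4 * ‖y‖ ^ 2 / (1 - η) := by
  intro M _ _ _ h Φ ρ A V η hη hA hV hΦ hρ hAV hdesc y hy hinj hcomp
  haveI hfd1 : FiniteDimensional ℝ (TangentSpace (𝓡 4) y) :=
    inferInstanceAs (FiniteDimensional ℝ (EuclideanSpace ℝ (Fin 4)))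
  set x := Φ y with hx
  haveI hfd2 : FiniteDimensional ℝ (TangentSpace (𝓡 4) x) :=
    inferInstanceAs (FiniteDimensional ℝ (EuclideanSpace ℝ (Fin 4)))
  have hΦy : MDifferentiableAt (𝓡 4) (𝓡 4) Φ y :=
    ((hΦ y hy).contMDiffAt (hA.mem_nhds hy)).mdifferentiableAt (by simp)
  have hρx : MDifferentiableAt (𝓡 4) 𝓘(ℝ, ℝ) ρ x :=
    ((hρ x (hAV hy)).contMDiffAt (hV.mem_nhds (hAV hy))).mdifferentiableAt (by simp)
  -- the differential of `ρ` at `x`, as a linear functional, and its metric dual `u = ♯dρ`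
  set α : TangentSpace (𝓡 4) x →ₗ[ℝ] ℝ :=
    (mvfderiv (𝓡 4) ρ x : TangentSpace (𝓡 4) x →ₗ[ℝ] ℝ) with hα
  set u : TangentSpace (𝓡 4) x := h.sharp x α with hu
  have hgrad : h.gradSq ρ x = α u := rfl
  have hval : ∀ w, h.val x u w = α w := fun w ↦ h.val_sharp_apply x α w
  have hαapp : ∀ w, α w = mfderiv (𝓡 4) 𝓘(ℝ, ℝ) ρ x w := fun w ↦ rfl
  -- `dΦ_y` is a linear bijection `ℝ⁴ → T_x M = ℝ⁴`
  set D : TangentSpace (𝓡 4) y →ₗ[ℝ] TangentSpace (𝓡 4) x :=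
    ((mfderiv (𝓡 4) (𝓡 4) Φ y : TangentSpace (𝓡 4) y →L[ℝ] TangentSpace (𝓡 4) x) :
      TangentSpace (𝓡 4) y →ₗ[ℝ] TangentSpace (𝓡 4) x) with hD
  have hDinj : Function.Injective D := hinj
  have hDsurj : Function.Surjective D :=
    (LinearMap.injective_iff_surjective_of_finrank_eq_finrank rfl).mp hDinj
  obtain ⟨v, hDv⟩ : ∃ v : EuclideanSpace ℝ (Fin 4), mfderiv (𝓡 4) (𝓡 4) Φ y v = u := hDsurj u
  -- chain rule: `dρ_x (dΦ_y v) = d(|·|²)_y v = 2⟪y, v⟫`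
  have hchain : α u = 2 * inner ℝ y v := by
    have hcompd : mfderiv (𝓡 4) 𝓘(ℝ, ℝ) (ρ ∘ Φ) y =
        (mfderiv (𝓡 4) 𝓘(ℝ, ℝ) ρ x).comp (mfderiv (𝓡 4) (𝓡 4) Φ y) := mfderiv_comp y hρx hΦy
    have hev : (ρ ∘ Φ) =ᶠ[𝓝 y] fun z : EuclideanSpace ℝ (Fin 4) ↦ ‖z‖ ^ 2 := by
      filter_upwards [hA.mem_nhds hy] with z hz using hdesc z hz
    have hsq : mfderiv (𝓡 4) 𝓘(ℝ, ℝ) (ρ ∘ Φ) y =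
        mfderiv 𝓘(ℝ, EuclideanSpace ℝ (Fin 4)) 𝓘(ℝ, ℝ) (fun z : EuclideanSpace ℝ (Fin 4) ↦ ‖z‖ ^ 2) y :=
      hev.mfderiv_eq
    have hflat : (mfderiv 𝓘(ℝ, EuclideanSpace ℝ (Fin 4)) 𝓘(ℝ, ℝ)
        (fun z : EuclideanSpace ℝ (Fin 4) ↦ ‖z‖ ^ 2) y v : ℝ) = 2 * inner ℝ y v := by
      rw [mfderiv_eq_fderiv, fderiv_norm_sq_apply]
      simp only [two_smul]
      change innerSL ℝ y v + innerSL ℝ y v = 2 * inner ℝ y v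
      rw [innerSL_apply_apply, two_mul]
    have e1 : (α u : ℝ) = (mfderiv (𝓡 4) 𝓘(ℝ, ℝ) (ρ ∘ Φ) y v : ℝ) := by
      rw [hαapp, ← hDv, hcompd]; rfl
    have e2 : (mfderiv (𝓡 4) 𝓘(ℝ, ℝ) (ρ ∘ Φ) y v : ℝ) =
        (mfderiv 𝓘(ℝ, EuclideanSpace ℝ (Fin 4)) 𝓘(ℝ, ℝ)
          (fun z : EuclideanSpace ℝ (Fin 4) ↦ ‖z‖ ^ 2) y v : ℝ) := by
      rw [hsq]; rfl
    exact e1.trans (e2.trans hflat)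
  -- the two estimates
  have hlow : (1 - η) * ‖v‖ ^ 2 ≤ α u := by
    have := hcomp v
    rwa [hDv, hval] at this
  have hup : α u ≤ 2 * (‖y‖ * ‖v‖) := by
    rw [hchain]
    have := real_inner_le_norm y v
    linarith
  rw [hgrad]
  have h1η : 0 < 1 - η := by linarith
  rw [le_div_iff₀ h1η]
  -- `G ≥ 0`, `G ≤ 2|y||v|`, `(1-η)|v|² ≤ G` ⇒ `G (1-η) ≤ 4|y|²`
  have hG0 : 0 ≤ α u := le_trans (by positivity) hlow
  by_cases hG : α u = 0
  · rw [hG, zero_mul]; positivity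
  · have hGpos : 0 < α u := lt_of_le_of_ne hG0 (Ne.symm hG)
    -- `G² ≤ 4|y|²|v|² ≤ 4|y|² G/(1-η)`
    have hsq : α u * α u ≤ 4 * ‖y‖ ^ 2 * ‖v‖ ^ 2 := by
      have h2 : 0 ≤ 2 * (‖y‖ * ‖v‖) := by positivity
      nlinarith [hup, hG0]
    have h3 : 4 * ‖y‖ ^ 2 * ‖v‖ ^ 2 * (1 - η) ≤ 4 * ‖y‖ ^ 2 * α u := by
      have := mul_le_mul_of_nonneg_left hlow (by positivity : (0 : ℝ) ≤ 4 * ‖y‖ ^ 2)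
      linarith
    nlinarith [hsq, h3, hGpos]

end GradSq

section Profile

/-- **The radial profile** `W(s) = e^{-s/8τ} · T(s/(2ε²) - 1) · T(3 - 4s/r'²)`: smooth, with values in
`[0, 1]`, vanishing for `s ≤ 2ε²` and for `s ≥ 3r'²/4`, hence with vanishing derivative on the open
flat zones `s < 2ε²`, `s > 3r'²/4`. [folklore] -/
theorem profile_props {τ ε r' : ℝ} (hτ : 0 < τ) (hε : 0 < ε) (hr' : 0 < r') (W : ℝ → ℝ)
    (hW : W = fun s : ℝ ↦ Real.exp (-s / (8 * τ)) *
        (Real.smoothTransition (s / (2 * ε ^ 2) - 1) * Real.smoothTransition (3 - 4 * s / r' ^ 2))) :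
    ContDiff ℝ ∞ W ∧ (∀ s, 0 ≤ W s) ∧ (∀ s, 0 ≤ s → W s ≤ 1) ∧
    (∀ s, s < 2 * ε ^ 2 ∨ 3 * r' ^ 2 / 4 < s → W s = 0 ∧ deriv W s = 0) ∧
    (∀ s, 2 * ε ^ 2 < s → s < 3 * r' ^ 2 / 4 → 0 < W s) := by
  have hsmooth : ContDiff ℝ ∞ W := by
    rw [hW]
    apply ContDiff.mul
    · exact Real.contDiff_exp.comp (by fun_prop)
    · exact (Real.smoothTransition.contDiff.comp (by fun_prop)).mul
        (Real.smoothTransition.contDiff.comp (by fun_prop))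
  -- zero set: closed flat zones
  have hzero : ∀ s, s ≤ 2 * ε ^ 2 ∨ 3 * r' ^ 2 / 4 ≤ s → W s = 0 := by
    intro s hs
    rw [hW]
    rcases hs with hs | hs
    · have h1 : Real.smoothTransition (s / (2 * ε ^ 2) - 1) = 0 := by
        apply Real.smoothTransition.zero_of_nonpos
        rw [sub_nonpos, div_le_one (by positivity)]
        exact hs
      simp only [h1, zero_mul, mul_zero]
    · have h1 : Real.smoothTransition (3 - 4 * s / r' ^ 2) = 0 := by
        apply Real.smoothTransition.zero_of_nonpos
        rw [sub_nonpos, le_div_iff₀ (by positivity)]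
        linarith only [hs]
      simp only [h1, mul_zero]
  refine ⟨hsmooth, fun s ↦ ?_, fun s hs ↦ ?_, fun s hs ↦ ?_, fun s hs1 hs2 ↦ ?_⟩
  · rw [hW]
    exact mul_nonneg (Real.exp_nonneg _) (mul_nonneg (Real.smoothTransition.nonneg _)
      (Real.smoothTransition.nonneg _))
  · have h1 : Real.exp (-s / (8 * τ)) ≤ 1 := by
      rw [Real.exp_le_one_iff, neg_div]; exact neg_nonpos.mpr (by positivity)
    have h2 : Real.smoothTransition (s / (2 * ε ^ 2) - 1) ≤ 1 := Real.smoothTransition.le_one _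
    have h3 : Real.smoothTransition (3 - 4 * s / r' ^ 2) ≤ 1 := Real.smoothTransition.le_one _
    have h2' := Real.smoothTransition.nonneg (s / (2 * ε ^ 2) - 1)
    have h3' := Real.smoothTransition.nonneg (3 - 4 * s / r' ^ 2)
    rw [hW]
    calc Real.exp (-s / (8 * τ)) *
          (Real.smoothTransition (s / (2 * ε ^ 2) - 1) * Real.smoothTransition (3 - 4 * s / r' ^ 2))
        ≤ 1 * (1 * 1) := by gcongr
      _ = 1 := by ring
  · -- open flat zones: `W` vanishes near `s`, so does its derivative
    have hev : W =ᶠ[𝓝 s] fun _ ↦ (0 : ℝ) := by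
      rcases hs with hs | hs
      · filter_upwards [Iio_mem_nhds hs] with t ht using hzero t (Or.inl (le_of_lt ht))
      · filter_upwards [Ioi_mem_nhds hs] with t ht using hzero t (Or.inr (le_of_lt ht))
    exact ⟨hzero s (hs.imp le_of_lt le_of_lt), by rw [hev.deriv_eq]; simp⟩
  · rw [hW]
    refine mul_pos (Real.exp_pos _) (mul_pos ?_ ?_)
    · apply Real.smoothTransition.pos_of_pos
      rw [sub_pos, one_lt_div (by positivity)]; exact hs1
    · apply Real.smoothTransition.pos_of_pos
      rw [sub_pos, div_lt_iff₀ (by positivity)]; linarith only [hs2]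

end Profile

end Summit.SmoothPoincare4.SmoothPoincare4.Theorems.SubcylindricalRecognition.AncientSphereRigidity

end
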